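import Summits.QuantumFields.YangMills.Theorems.LuscherReductionTraceDoorOST
import Summits.QuantumFields.YangMills.Theorems.LuscherReductionRunningReductionTraceFormula
import Summits.QuantumFields.YangMills.Theorems.LuscherReductionRunningReductionLevelGapSummable
import Summits.QuantumFields.YangMills.Theorems.LuscherReductionRunningReductionBOHandoverLabels
import HarnessLib

/-!
# S-BASE of line «twolattice» (crux `TwistedTraceScaling`, stmt-QuantumFields-20203) — part 1 of its reduction to fixed-lattice level
# statements: window bookkeeping at a fixed lattice size, LEVEL = TRACE currency on any lattice, femto steps, elementary lemmas

Route `LuscherReduction` (owner ym-beyond-p1), child crux `TwistedTraceScaling` (stmt-QuantumFields-20203), registered birth line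
«twolattice» (`pub/ym-beyond/p1-g20-files/Lines-twolattice.lean`, sha16 a5c3dbcbf75f28d1), stub S-BASE `Stmt.stub_fixedLatticeTraceLaw`
(fixed lattice `(ℤ/L₁)³`, `β → ∞`: the zero-flux dyadic trace ratio at `T = ⌈sL₁/Λ(β,L₁)⌉` tends to Lüscher's `r_𝔥(s)`).  The reduction
of S-BASE to COARSE-UPPER/LOWER/TAIL(L₁) is `Base.fixedLatticeTraceLaw_of_coarse` in
`Theorems/LuscherReductionTwistedTraceScalingBaseOfCoarse.lean`; this file holds its bookkeeping:

* §1 `β → ∞` at fixed `L₁` ⇔ `lam → 0` in `InFemtoWindow lam β L₁`: the two-loop label `1/ḡ²(β,L₁)` is unbounded in `β`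
  (`invRunningCoupling_ge'`), hence deep windows exist at large `β` (`exists_window_of_large_beta`, `eventually_of_window`) and the femto
  unit `u = Λ(β,L₁)/L₁` is eventually small (`eventually_unit_le`);
* §2 LEVEL = TRACE currency on ANY lattice size (`traceRatio_eq_levelRatio`, from the closed child `TraceFormula` = tree
  `TT.traceFormula_all`), summability of `(λ_k/λ_0)^T` for `T ≥ 2`, and `s ≤ T·u ≤ s + u` at `T = femtoSteps s β L₁`;
* §3 elementary: the exponential sandwich `e^{−a∓ρ}` (`levelGap` basics and tail shifts are the tree's `TraceDoor.levelGap_nonneg`,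
  `levelGap_zero`, `TraceDoor.OST.tsum_shift_le`).

HONEST FRAMING: bookkeeping only (no semiclassics, no RG); femto rung R2b1; not infinite volume, not a gap, not Clay.
-/

set_option autoImplicit false

noncomputable section

open MeasureTheory Filter Topology Real
open Literature.MathematicalPhysics.QuantumFieldTheory hiding SU2
open Literature.MathematicalPhysics.QuantumLattice
open Literature.Analysis.OperatorTheory.YMMatrixModel
open scoped BigOperators

namespace Summit.QuantumFields.YangMills.Theorems.FemtoTransferGap.TwoLattice

open Summit.QuantumFields.YangMills.Theorems.FemtoTransferGap
open Summit.QuantumFields.YangMills.Theorems.FemtoTransferGap.TraceDoor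
open Summit.QuantumFields.YangMills.Theorems.FemtoTransferGap.TT (physTrace)

namespace Base

/-! ## §1 Window bookkeeping at a fixed lattice size: `β → ∞` is `lam → 0` -/

/-- `b₁/(2b₀²) = 51/121`. [cite: HasenfratzHasenfratz1980, p. 165] -/
theorem b1_div_two_b0_sq' : b1 / (2 * b0 ^ 2) = 51 / 121 := by
  unfold b0 b1
  have hπ : (π : ℝ) ≠ 0 := Real.pi_ne_zero
  rw [div_eq_div_iff (by positivity) (by norm_num)]
  ring

/-- Linear lower bound for the two-loop label: `1/ḡ²(β, L₁) ≥ (19/242)β + b₁/b₀ − 2b₀ log L₁` (from `log x ≥ 1 − 1/x`); in particular the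
label is unbounded in `β` at fixed `L₁`. [folklore] -/
theorem invRunningCoupling_ge' {β : ℝ} (hβ : 0 < β) (L1 : ℕ) :
    β * (19 / 242) + (b1 / b0 - 2 * b0 * Real.log (L1 : ℝ)) ≤ invRunningCoupling β L1 := by
  rw [BOHandover.invRunningCoupling_eq]
  have hb0 : 0 < b0 := by unfold b0; positivity
  have hb1 : 0 < b1 := by unfold b1; positivity
  have hx : 0 < 2 * b0 / β := by positivity
  have hlog : 1 - (2 * b0 / β)⁻¹ ≤ Real.log (2 * b0 / β) := Real.one_sub_inv_le_log_of_pos hx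
  rw [inv_div] at hlog
  have hK : 0 ≤ b1 / b0 := (div_pos hb1 hb0).le
  have h1 : (b1 / b0) * (1 - β / (2 * b0)) ≤ (b1 / b0) * Real.log (2 * b0 / β) :=
    mul_le_mul_of_nonneg_left hlog hK
  have h2 : (b1 / b0) * (1 - β / (2 * b0)) = b1 / b0 - (b1 / (2 * b0 ^ 2)) * β := by ring
  rw [h2, b1_div_two_b0_sq'] at h1
  linarith

/-- **Deep windows exist at large `β`** (fixed lattice size `L₁`): for every `lam0 > 0` there is `β₁` such that every `β ≥ β₁` lies in
the femto window `InFemtoWindow lam β L₁` for some `0 < lam ≤ lam0` (namely `lam = Λ(β,L₁)/2`). [folklore] -/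
theorem exists_window_of_large_beta (L1 : ℕ) [NeZero L1] {lam0 : ℝ} (hlam0 : 0 < lam0) :
    ∃ β1 : ℝ, ∀ β : ℝ, β1 ≤ β → ∃ lam : ℝ, 0 < lam ∧ lam ≤ lam0 ∧ InFemtoWindow lam β L1 := by
  set K : ℝ := b1 / b0 - 2 * b0 * Real.log (L1 : ℝ) with hK
  set v : ℝ := 1 / (2 * lam0) ^ 3 with hv
  have hvpos : 0 < v := by rw [hv]; positivity
  refine ⟨max 1 ((v - K) * (242 / 19)), fun β hβ => ?_⟩
  have hβ1 : 1 ≤ β := le_trans (le_max_left _ _) hβ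
  have hβ0 : 0 < β := by linarith
  have hinv : v ≤ invRunningCoupling β L1 := by
    have hge := invRunningCoupling_ge' hβ0 L1
    have hb : (v - K) * (242 / 19) ≤ β := le_trans (le_max_right _ _) hβ
    rw [← hK] at hge
    linarith
  have hinvpos : 0 < invRunningCoupling β L1 := lt_of_lt_of_le hvpos hinv
  have hl3 : luscherLambda β L1 ^ 3 = (invRunningCoupling β L1)⁻¹ := BOHandover.luscherLambda_pow_three hinvpos
  have hlpos : 0 < luscherLambda β L1 := by
    have h3 : 0 < luscherLambda β L1 ^ 3 := by rw [hl3]; exact inv_pos.2 hinvpos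
    rcases lt_trichotomy (luscherLambda β L1) 0 with h | h | h
    · exact absurd h3 (not_lt.2 (by
        have : luscherLambda β L1 ^ 3 = luscherLambda β L1 * luscherLambda β L1 ^ 2 := by ring
        rw [this]; exact mul_nonpos_of_nonpos_of_nonneg h.le (sq_nonneg _)))
    · rw [h] at h3; norm_num at h3
    · exact h
  have hle : luscherLambda β L1 ≤ 2 * lam0 := by
    have h3 : luscherLambda β L1 ^ 3 ≤ (2 * lam0) ^ 3 := by
      rw [hl3]
      have : (invRunningCoupling β L1)⁻¹ ≤ v⁻¹ := inv_anti₀ hvpos hinv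
      rw [hv, one_div, inv_inv] at this
      exact this
    exact (pow_le_pow_iff_left₀ hlpos.le (by positivity) (by norm_num : (3 : ℕ) ≠ 0)).1 h3
  refine ⟨luscherLambda β L1 / 2, by positivity, by linarith, hβ1, by linarith, by linarith⟩

/-- In a window at `L₁` the femto unit `u = Λ(β,L₁)/L₁` is positive. [folklore] -/
theorem unit_pos_of_window {lam β : ℝ} {L1 : ℕ} [NeZero L1] (hlam : 0 < lam) (hW : InFemtoWindow lam β L1) :
    0 < luscherLambda β L1 / L1 :=
  div_pos (luscherLambda_pos_of_window hlam hW) (by exact_mod_cast Nat.pos_of_ne_zero (NeZero.ne L1))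

/-- In a window at `L₁` of depth `lam` the femto unit is at most `2·lam` (`Λ ≤ 2 lam`, `L₁ ≥ 1`). [folklore] -/
theorem unit_le_of_window {lam β : ℝ} {L1 : ℕ} [NeZero L1] (hlam : 0 < lam) (hW : InFemtoWindow lam β L1) :
    luscherLambda β L1 / L1 ≤ 2 * lam := by
  have hL1 : (1 : ℝ) ≤ (L1 : ℝ) := by exact_mod_cast NeZero.one_le
  have hl : 0 ≤ luscherLambda β L1 := (luscherLambda_pos_of_window hlam hW).le
  calc luscherLambda β L1 / L1 ≤ luscherLambda β L1 / 1 :=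
        div_le_div_of_nonneg_left hl one_pos hL1
    _ = luscherLambda β L1 := div_one _
    _ ≤ 2 * lam := hW.2.2

/-- **From window statements to `β`-thresholds.**  If a property of `β` holds deep in the window at `L₁` (for all `0 < lam ≤ lam0` and
all `β` with `InFemtoWindow lam β L₁`), then it holds for all large `β`. [folklore] -/
theorem eventually_of_window (L1 : ℕ) [NeZero L1] {P : ℝ → Prop} {lam0 : ℝ} (hlam0 : 0 < lam0)
    (h : ∀ lam : ℝ, 0 < lam → lam ≤ lam0 → ∀ β : ℝ, InFemtoWindow lam β L1 → P β) :
    ∃ β1 : ℝ, ∀ β : ℝ, β1 ≤ β → P β := by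
  obtain ⟨β1, hβ1⟩ := exists_window_of_large_beta L1 hlam0
  refine ⟨β1, fun β hβ => ?_⟩
  obtain ⟨lam, hlam, hle, hW⟩ := hβ1 β hβ
  exact h lam hlam hle β hW

/-- The femto unit is eventually small: for every `τ > 0`, `u(β) = Λ(β,L₁)/L₁ ≤ τ` and `0 < u(β)` and `1 ≤ β` for all large `β`. [folklore] -/
theorem eventually_unit_le (L1 : ℕ) [NeZero L1] {τ : ℝ} (hτ : 0 < τ) :
    ∃ β1 : ℝ, ∀ β : ℝ, β1 ≤ β → 1 ≤ β ∧ 0 < luscherLambda β L1 / L1 ∧ luscherLambda β L1 / L1 ≤ τ := by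
  have h2 : 0 < τ / 2 := by positivity
  obtain ⟨β1, hβ1⟩ := exists_window_of_large_beta L1 h2
  refine ⟨β1, fun β hβ => ?_⟩
  obtain ⟨lam, hlam, hle, hW⟩ := hβ1 β hβ
  exact ⟨hW.1, unit_pos_of_window hlam hW, (unit_le_of_window hlam hW).trans (by linarith)⟩

/-! ## §2 LEVEL = TRACE currency on any lattice (closed child `TraceFormula`), and the femto steps -/

/-- `Z_phys(L, β, T) = λ₀^T · m(L, β, T)` for `β ≥ 1`, `T ≥ 2` (tree `TT.traceFormula_all`). [cite: MontvayMunster1994, (3.145)] -/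
theorem physTrace_eq_mul_levelMoment (L : ℕ) [NeZero L] {β : ℝ} (hβ : 1 ≤ β) {T : ℕ} (hT : 2 ≤ T) :
    physTrace L β T = levelValue su2Rep L β 0 ^ T * levelMoment L β T := by
  have hTF := TT.traceFormula_all L β T hβ hT
  have h0 : 0 < levelValue su2Rep L β 0 := levelValue_zero_su2Rep_pos L β
  have h0T : levelValue su2Rep L β 0 ^ T ≠ 0 := (pow_pos h0 T).ne'
  unfold levelMoment
  have hk : ∀ k : ℕ, (levelValue su2Rep L β k / levelValue su2Rep L β 0) ^ T =
      levelValue su2Rep L β k ^ T / levelValue su2Rep L β 0 ^ T := fun k => div_pow _ _ _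
  simp_rw [hk, tsum_div_const, hTF.tsum_eq]
  rw [← mul_div_assoc, mul_div_cancel_left₀ _ h0T]

/-- The dyadic TRACE ratio of any lattice is its dyadic LEVEL ratio (`β ≥ 1`, `T ≥ 2`). [cite: MontvayMunster1994, (3.145)] -/
theorem traceRatio_eq_levelRatio (L : ℕ) [NeZero L] {β : ℝ} (hβ : 1 ≤ β) {T : ℕ} (hT : 2 ≤ T) :
    traceRatio L β T = levelRatio L β T := by
  have h0 : 0 < levelValue su2Rep L β 0 := levelValue_zero_su2Rep_pos L β
  have hc : levelValue su2Rep L β 0 ^ (2 * T) ≠ 0 := (pow_pos h0 _).ne'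
  unfold traceRatio levelRatio
  rw [physTrace_eq_mul_levelMoment L hβ (by omega : 2 ≤ 2 * T), physTrace_eq_mul_levelMoment L hβ hT, mul_pow, ← pow_mul,
    mul_comm T 2]
  exact mul_div_mul_left _ _ hc

/-- The relative levels `x_k^T` are summable for `β ≥ 1`, `T ≥ 2` (from `TraceFormula`). [cite: ReedSimonIV1978, Thm. XIII.1] -/
theorem summable_xpow (L : ℕ) [NeZero L] {β : ℝ} (hβ : 1 ≤ β) {T : ℕ} (hT : 2 ≤ T) :
    Summable fun k : ℕ => (levelValue su2Rep L β k / levelValue su2Rep L β 0) ^ T := by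
  have hTF := TT.traceFormula_all L β T hβ hT
  have hk : (fun k : ℕ => (levelValue su2Rep L β k / levelValue su2Rep L β 0) ^ T) =
      fun k : ℕ => levelValue su2Rep L β k ^ T / levelValue su2Rep L β 0 ^ T := by
    funext k; exact div_pow _ _ _
  rw [hk]
  exact hTF.summable.div_const _

/-- At `T = femtoSteps s β L₁` the femto time in units `u = Λ/L₁` is pinned: `s ≤ T·u` and `T·u ≤ s + u` (`u > 0`). [folklore] -/
theorem femtoSteps_mul_unit {s lam β : ℝ} {L1 : ℕ} [NeZero L1] (hs : 0 ≤ s) (hlam : 0 < lam) (hW : InFemtoWindow lam β L1) :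
    s ≤ (femtoSteps s β L1 : ℝ) * (luscherLambda β L1 / L1) ∧
      (femtoSteps s β L1 : ℝ) * (luscherLambda β L1 / L1) ≤ s + luscherLambda β L1 / L1 := by
  have hl : 0 < luscherLambda β L1 := luscherLambda_pos_of_window hlam hW
  have hL0 : (0 : ℝ) < (L1 : ℝ) := by exact_mod_cast Nat.pos_of_ne_zero (NeZero.ne L1)
  have hu : 0 < luscherLambda β L1 / L1 := div_pos hl hL0
  have hx : 0 ≤ s * L1 / luscherLambda β L1 := by positivity
  have hc1 : s * L1 / luscherLambda β L1 ≤ (femtoSteps s β L1 : ℝ) := Nat.le_ceil _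
  have hc2 : (femtoSteps s β L1 : ℝ) < s * L1 / luscherLambda β L1 + 1 := Nat.ceil_lt_add_one hx
  have e1 : s * L1 / luscherLambda β L1 * (luscherLambda β L1 / L1) = s := by field_simp
  constructor
  · calc s = s * L1 / luscherLambda β L1 * (luscherLambda β L1 / L1) := e1.symm
      _ ≤ (femtoSteps s β L1 : ℝ) * (luscherLambda β L1 / L1) := mul_le_mul_of_nonneg_right hc1 hu.le
  · have : (femtoSteps s β L1 : ℝ) * (luscherLambda β L1 / L1) ≤
        (s * L1 / luscherLambda β L1 + 1) * (luscherLambda β L1 / L1) := mul_le_mul_of_nonneg_right hc2.le hu.le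
    have e2 : (s * L1 / luscherLambda β L1 + 1) * (luscherLambda β L1 / L1) = s + luscherLambda β L1 / L1 := by
      rw [add_mul, e1, one_mul]
    linarith

/-! ## §3 Elementary lemmas -/

/-- Elementary: `e^{−a−ρ} ≤ x ≤ e^{−a+ρ}` with `a ≥ 0`, `0 ≤ ρ ≤ 1` forces `|x − e^{−a}| ≤ 2ρ`. [folklore] -/
theorem abs_sub_exp_le_of_sandwich {x a ρ : ℝ} (ha : 0 ≤ a) (hρ0 : 0 ≤ ρ) (hρ1 : ρ ≤ 1)
    (hlow : Real.exp (-a - ρ) ≤ x) (hup : x ≤ Real.exp (-a + ρ)) : |x - Real.exp (-a)| ≤ 2 * ρ := by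
  have hE : Real.exp (-a) ≤ 1 := by rw [Real.exp_le_one_iff]; linarith
  have hEpos : 0 < Real.exp (-a) := Real.exp_pos _
  have hEρ : Real.exp (-a) * ρ ≤ ρ := mul_le_of_le_one_left hρ0 hE
  rw [abs_le]
  constructor
  · have h1 : Real.exp (-a - ρ) = Real.exp (-a) * Real.exp (-ρ) := by rw [sub_eq_add_neg, Real.exp_add]
    have h2 : 1 - ρ ≤ Real.exp (-ρ) := by have := Real.add_one_le_exp (-ρ); linarith
    have h3 : Real.exp (-a) * (1 - ρ) ≤ x := by
      calc Real.exp (-a) * (1 - ρ) ≤ Real.exp (-a) * Real.exp (-ρ) := mul_le_mul_of_nonneg_left h2 hEpos.le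
        _ = Real.exp (-a - ρ) := h1.symm
        _ ≤ x := hlow
    have h4 : Real.exp (-a) * (1 - ρ) = Real.exp (-a) - Real.exp (-a) * ρ := by ring
    linarith
  · have h1 : Real.exp (-a + ρ) = Real.exp (-a) * Real.exp ρ := Real.exp_add _ _
    have h2 : Real.exp ρ ≤ 1 + 2 * ρ := by
      have hh := Real.abs_exp_sub_one_le (x := ρ) (by rw [abs_of_nonneg hρ0]; exact hρ1)
      rw [abs_of_nonneg hρ0] at hh
      have := (abs_le.1 hh).2; linarith
    have h3 : x ≤ Real.exp (-a) * (1 + 2 * ρ) :=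
      hup.trans (by rw [h1]; exact mul_le_mul_of_nonneg_left h2 hEpos.le)
    have h4 : Real.exp (-a) * (1 + 2 * ρ) = Real.exp (-a) + 2 * (Real.exp (-a) * ρ) := by ring
    linarith

end Base

end Summit.QuantumFields.YangMills.Theorems.FemtoTransferGap.TwoLattice

end
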